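import Literature.Barriers.CriticalPhenomena.SAPCanonical
import Literature.Barriers.CriticalPhenomena.SAPStretch
import HarnessLib

/-!
# Section columns and the contraction of a polygon (haruspicy, layer 4a)

Companion of `SAPAnisotropicNotDFinite` (towards `Rechnitzer2006_thm1`). For a canonical word
`u` (`Haruspicy.IsCanon`: a self-avoiding polygon rooted at its least vertex, first letter `E`)
we introduce

* `secCols u` — the **section columns**: the columns `x` carrying a vertical bond of `u`
  (Rechnitzer's section lines are obstructed exactly by vertical bonds, §2.1, Definition 2);
* `IsColMin u` — **column-minimal** words: every visited column is a section column (no column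
  can be deleted; the coarse form of Rechnitzer's section-minimal polygons, Definition 4);
* `theta u`, `contract u`, `tauOf u` — the width function collapsing every maximal run of
  non-section columns, the contracted word `contract u = restretch (chi u) 0 u` (delete the
  horizontal bonds whose gap does not start at a section column) and the widths `tauOf u`
  re-inflating it;

and prove: the walk passes straight through non-section columns (`IsSAP.straight`), the
minimal and maximal columns are section columns, `restretch (theta u) 0 u = u`
(`IsCanon.restretch_theta`), `restretch (tauOf u) 0 (contract u) = u`
(`IsCanon.restretch_tauOf_contract`), and that `contract u` is again canonical, is
column-minimal and has the same vertical bonds (`IsCanon.isCanon_contract`,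
`IsCanon.isColMin_contract`, `vcount_contract`). [folklore] throughout.

## References

* A. Rechnitzer, *Haruspicy 2*, J. Combin. Theory Ser. A 113 (2006), §2.1 (Definitions 2–4,
  Lemma 5). [Rechnitzer2006Haruspicy2]
-/

noncomputable section

open Finset Literature.Probability.LatticeModels Literature.Probability.Percolation
open scoped BigOperators

namespace Literature.Barriers.CriticalPhenomena

namespace Haruspicy

open Edwards2D

variable {u w : List (Fin 4)}

/-! ### Sites by coordinates; letter counts -/

/-- Two sites of `ℤ²` agree iff both coordinates agree (the statement of
`Literature.Probability.LatticeModels.Site.eq_iff_two` in `Percolation/PlanarDuality.lean`,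
restated here to keep the import closure of this purely combinatorial file small). [folklore] -/
theorem site_eq_iff {a b : Site 2} : a = b ↔ a 0 = b 0 ∧ a 1 = b 1 := by
  constructor
  · rintro rfl
    exact ⟨rfl, rfl⟩
  · rintro ⟨h0, h1⟩
    funext i
    fin_cases i
    · exact h0
    · exact h1

/-- The `x`-displacement of a word is `#E - #W`. [folklore] -/
theorem sum_map_stepVec_apply_zero (w : List (Fin 4)) :
    (w.map stepVec).sum 0 = (w.count 0 : ℤ) - w.count 1 := by
  induction w with
  | nil => simp
  | cons a w ih =>
    rw [List.map_cons, List.sum_cons, Pi.add_apply, ih, List.count_cons, List.count_cons]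
    fin_cases a <;> simp <;> ring

/-- The `y`-displacement of a word is `#N - #S`. [folklore] -/
theorem sum_map_stepVec_apply_one (w : List (Fin 4)) :
    (w.map stepVec).sum 1 = (w.count 2 : ℤ) - w.count 3 := by
  induction w with
  | nil => simp
  | cons a w ih =>
    rw [List.map_cons, List.sum_cons, Pi.add_apply, ih, List.count_cons, List.count_cons]
    fin_cases a <;> simp <;> ring

/-- `hcount = #E + #W`. [folklore] -/
theorem hcount_eq_count (w : List (Fin 4)) : hcount w = w.count 0 + w.count 1 := by
  induction w with
  | nil => rfl
  | cons a w ih =>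
    have h : hcount (a :: w) = hcount w + if a.val < 2 then 1 else 0 := by
      simp [hcount, List.countP_cons]
    rw [h, ih, List.count_cons, List.count_cons]
    fin_cases a <;> simp <;> omega

/-- `vcount = #N + #S`. [folklore] -/
theorem vcount_eq_count (w : List (Fin 4)) : vcount w = w.count 2 + w.count 3 := by
  induction w with
  | nil => rfl
  | cons a w ih =>
    have h : vcount (a :: w) = vcount w + if 2 ≤ a.val then 1 else 0 := by
      simp [vcount, List.countP_cons]
    rw [h, ih, List.count_cons, List.count_cons]
    fin_cases a <;> simp <;> omega

/-- The vertical count of a prefix is at most that of the word. [folklore] -/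
theorem vcount_take_le (w : List (Fin 4)) (k : ℕ) : vcount (w.take k) ≤ vcount w :=
  (List.take_sublist k w).countP_le

/-- Heights are bounded by the number of vertical letters. [folklore] -/
theorem abs_vtx_one_le (w : List (Fin 4)) (k : ℕ) : |vtx w k 1| ≤ vcount w := by
  rw [vtx, sum_map_stepVec_apply_one]
  have h := vcount_eq_count (w.take k)
  have h' := vcount_take_le w k
  rw [abs_le]
  constructor <;> omega

/-! ### Discrete continuity of the columns -/

/-- Consecutive vertices differ by at most one column. [folklore] -/
theorem abs_vtx_succ_sub_le (w : List (Fin 4)) (i : ℕ) : |vtx w (i + 1) 0 - vtx w i 0| ≤ 1 := by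
  by_cases hi : i < w.length
  · rw [vtx_succ w hi, Pi.add_apply, add_sub_cancel_left]
    generalize w[i] = a
    fin_cases a <;> simp
  · rw [vtx_of_length_le w (show w.length ≤ i + 1 by omega),
      vtx_of_length_le w (show w.length ≤ i by omega), sub_self]
    simp

/-- **Discrete intermediate value property**: every column between two visited columns is
visited in between. [folklore] -/
theorem exists_vtx_zero_eq (w : List (Fin 4)) {i j : ℕ} (hij : i ≤ j) {c : ℤ}
    (h1 : min (vtx w i 0) (vtx w j 0) ≤ c) (h2 : c ≤ max (vtx w i 0) (vtx w j 0)) :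
    ∃ k, i ≤ k ∧ k ≤ j ∧ vtx w k 0 = c := by
  induction j, hij using Nat.le_induction with
  | base => exact ⟨i, le_rfl, le_rfl, by omega⟩
  | succ j hij ih =>
    have hstep := abs_vtx_succ_sub_le w j
    rw [abs_le] at hstep
    by_cases hc : min (vtx w i 0) (vtx w j 0) ≤ c ∧ c ≤ max (vtx w i 0) (vtx w j 0)
    · obtain ⟨k, hk1, hk2, hk3⟩ := ih hc.1 hc.2
      exact ⟨k, hk1, by omega, hk3⟩
    · exact ⟨j + 1, by omega, le_rfl, by omega⟩

/-! ### Section columns -/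

/-- The **section columns** of a word: the columns of its vertical letters (the vertical bonds
obstructing Rechnitzer's section lines). [cite: Rechnitzer2006Haruspicy2, §2.1, Definition 2] -/
def secCols (u : List (Fin 4)) : Finset ℤ :=
  ((Finset.range u.length).filter fun i => 2 ≤ (u.getD i 0).val).image fun i => vtx u i 0

/-- Membership in `secCols`. [folklore] -/
theorem mem_secCols {c : ℤ} :
    c ∈ secCols u ↔ ∃ i < u.length, 2 ≤ (u.getD i 0).val ∧ vtx u i 0 = c := by
  simp [secCols, and_assoc]

/-- The vertical letters, counted by index. [folklore] -/
theorem card_filter_vertical (u : List (Fin 4)) :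
    ((Finset.range u.length).filter fun i => 2 ≤ (u.getD i 0).val).card = vcount u := by
  induction u using List.reverseRecOn with
  | nil => rfl
  | append_singleton u a ih =>
    rw [List.length_append, List.length_singleton, Finset.range_add_one, Finset.filter_insert,
      vcount_append, ← ih]
    have hcongr : (Finset.range u.length).filter (fun i => 2 ≤ ((u ++ [a]).getD i 0).val) =
        (Finset.range u.length).filter (fun i => 2 ≤ (u.getD i 0).val) := by
      apply Finset.filter_congr
      intro i hi
      rw [Finset.mem_range] at hi
      rw [List.getD_append _ _ _ _ hi]
    rw [List.getD_append_right _ _ _ _ le_rfl, Nat.sub_self, List.getD_cons_zero]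
    split_ifs with ha
    · rw [Finset.card_insert_of_notMem (by simp), hcongr]
      simp [vcount, ha]
    · rw [hcongr]
      simp [vcount, ha]

/-- There are at most `vcount` section columns. [folklore] -/
theorem card_secCols_le (u : List (Fin 4)) : (secCols u).card ≤ vcount u := by
  rw [← card_filter_vertical]
  exact Finset.card_image_le

/-- **Column-minimal** words: every visited column carries a vertical bond, so that no column is
a duplicate of its neighbour (the coarse form of section-minimality).
[cite: Rechnitzer2006Haruspicy2, §2.1, Definition 4] -/
def IsColMin (u : List (Fin 4)) : Prop :=
  ∀ i < u.length, vtx u i 0 ∈ secCols u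

/-- A vertical letter does not move the column. [folklore] -/
theorem stepVec_apply_zero_eq_zero {a : Fin 4} (ha : 2 ≤ a.val) : stepVec a 0 = 0 := by
  fin_cases a <;> simp at ha ⊢

/-- A horizontal letter does not move the height. [folklore] -/
theorem stepVec_apply_one_eq_zero {a : Fin 4} (ha : a.val < 2) : stepVec a 1 = 0 := by
  fin_cases a <;> simp at ha ⊢

/-- **Straight through non-section columns**: at a vertex in a column without vertical bonds the
walk repeats its previous (horizontal) letter. [folklore] -/
theorem IsSAP.straight (h : IsSAP u) {j : ℕ} (hj : j + 1 < u.length)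
    (hns : vtx u (j + 1) 0 ∉ secCols u) :
    u.getD (j + 1) 0 = u.getD j 0 ∧ (u.getD (j + 1) 0).val < 2 := by
  have hj' : j < u.length := by omega
  have hv1 : (u.getD (j + 1) 0).val < 2 := by
    by_contra hv
    exact hns (mem_secCols.2 ⟨j + 1, hj, not_lt.1 hv, rfl⟩)
  have hv0 : (u.getD j 0).val < 2 := by
    by_contra hv
    apply hns
    rw [mem_secCols]
    refine ⟨j, hj', not_lt.1 hv, ?_⟩
    rw [vtx_succ u hj', Pi.add_apply, ← List.getD_eq_getElem u 0 hj',
      stepVec_apply_zero_eq_zero (not_lt.1 hv), add_zero]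
  refine ⟨?_, hv1⟩
  by_contra hne
  -- two distinct horizontal letters are opposite: the walk backtracks
  have hsum : stepVec (u.getD j 0) + stepVec (u.getD (j + 1) 0) = 0 := by
    generalize u.getD j 0 = a at *
    generalize u.getD (j + 1) 0 = b at *
    fin_cases a <;> fin_cases b <;> simp at hv0 hv1 hne ⊢
  have hv : vtx u (j + 2) = vtx u j := by
    rw [show j + 2 = j + 1 + 1 by ring, vtx_succ u hj, vtx_succ u hj', add_assoc,
      ← List.getD_eq_getElem u 0 hj', ← List.getD_eq_getElem u 0 hj, hsum, add_zero]
  have hm := h.mod_eq_mod (show j + 2 ≤ u.length by omega) hj'.le hv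
  rw [Nat.mod_eq_of_lt hj'] at hm
  have h4 := h.1
  rcases (show j + 2 < u.length ∨ j + 2 = u.length by omega) with hlt | heq
  · rw [Nat.mod_eq_of_lt hlt] at hm
    omega
  · rw [heq, Nat.mod_self] at hm
    omega

/-! ### Canonical words: extreme columns are section columns -/

/-- The column of the `N`-th vertex of a closed word is `0`. [folklore] -/
theorem IsSAP.vtx_length_zero (h : IsSAP u) : vtx u u.length 0 = 0 := by
  rw [vtx_length, h.2.1]
  rfl

/-- The last vertex before closing of a canonical word is in column `0`, and the last letter is
`S`. [folklore] -/
theorem IsCanon.getD_length_sub_one (h : IsCanon u) :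
    u.getD (u.length - 1) 0 = 3 ∧ vtx u (u.length - 1) 0 = 0 := by
  have hN : u.length - 1 < u.length := by have := h.1.1; omega
  have hlast : u.getD (u.length - 1) 0 = 3 := by
    have := h.getLast?
    rw [List.getLast?_eq_getElem?, List.getElem?_eq_getElem hN] at this
    rw [List.getD_eq_getElem _ _ hN]
    exact Option.some.inj this
  refine ⟨hlast, ?_⟩
  have := vtx_succ u hN
  rw [Nat.sub_add_cancel (by omega), ← List.getD_eq_getElem u 0 hN, hlast] at this
  have h0 := h.1.vtx_length_zero
  rw [this, Pi.add_apply] at h0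
  simpa using h0

/-- `0` is a section column of a canonical word (its last bond is vertical, into the root).
[folklore] -/
theorem IsCanon.zero_mem_secCols (h : IsCanon u) : (0 : ℤ) ∈ secCols u := by
  have hN : u.length - 1 < u.length := by have := h.1.1; omega
  obtain ⟨h3, h0⟩ := h.getD_length_sub_one
  exact mem_secCols.2 ⟨u.length - 1, hN, by rw [h3]; decide, h0⟩

/-- The **leftmost column** of a canonical word is a section column, below every vertex column.
[folklore] -/
theorem IsCanon.exists_secCol_le (h : IsCanon u) :
    ∃ a ∈ secCols u, ∀ i ≤ u.length, a ≤ vtx u i 0 := by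
  have hN : 0 < u.length := h.1.length_pos
  obtain ⟨j, hj, hmin⟩ := Finset.exists_min_image (Finset.range u.length) (fun i => vtx u i 0)
    ⟨0, by simpa using hN⟩
  rw [Finset.mem_range] at hj
  have hmin' : ∀ i ≤ u.length, vtx u j 0 ≤ vtx u i 0 := by
    intro i hi
    rcases hi.lt_or_eq with hlt | rfl
    · exact hmin i (by simpa using hlt)
    · rw [h.1.vtx_length_zero]
      simpa using hmin 0 (by simpa using hN)
  refine ⟨vtx u j 0, ?_, hmin'⟩
  rcases Nat.eq_zero_or_pos j with rfl | hjpos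
  · rw [vtx_zero]
    exact h.zero_mem_secCols
  · by_contra hns
    obtain ⟨k, rfl⟩ : ∃ k, j = k + 1 := ⟨j - 1, by omega⟩
    obtain ⟨heq, hhor⟩ := h.1.straight hj hns
    have hk : k < u.length := by omega
    have h1 := vtx_succ u hk
    have h2 := vtx_succ u hj
    rw [← List.getD_eq_getElem u 0 hk, ← heq] at h1
    rw [← List.getD_eq_getElem u 0 hj] at h2
    have hA := hmin' k hk.le
    have hB := hmin' (k + 1 + 1) hj
    rw [h2, Pi.add_apply] at hB
    rw [h1, Pi.add_apply] at hA
    generalize u.getD (k + 1) 0 = a at *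
    fin_cases a <;> simp at hhor hA hB

/-- The **rightmost column** of a canonical word is a section column, above every vertex column.
[folklore] -/
theorem IsCanon.exists_secCol_ge (h : IsCanon u) :
    ∃ b ∈ secCols u, ∀ i ≤ u.length, vtx u i 0 ≤ b := by
  have hN : 0 < u.length := h.1.length_pos
  obtain ⟨j, hj, hmax⟩ := Finset.exists_max_image (Finset.range u.length) (fun i => vtx u i 0)
    ⟨0, by simpa using hN⟩
  rw [Finset.mem_range] at hj
  have hmax' : ∀ i ≤ u.length, vtx u i 0 ≤ vtx u j 0 := by
    intro i hi
    rcases hi.lt_or_eq with hlt | rfl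
    · exact hmax i (by simpa using hlt)
    · rw [h.1.vtx_length_zero]
      simpa using hmax 0 (by simpa using hN)
  refine ⟨vtx u j 0, ?_, hmax'⟩
  rcases Nat.eq_zero_or_pos j with rfl | hjpos
  · rw [vtx_zero]
    exact h.zero_mem_secCols
  · by_contra hns
    obtain ⟨k, rfl⟩ : ∃ k, j = k + 1 := ⟨j - 1, by omega⟩
    obtain ⟨heq, hhor⟩ := h.1.straight hj hns
    have hk : k < u.length := by omega
    have h1 := vtx_succ u hk
    have h2 := vtx_succ u hj
    rw [← List.getD_eq_getElem u 0 hk, ← heq] at h1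
    rw [← List.getD_eq_getElem u 0 hj] at h2
    have hA := hmax' k hk.le
    have hB := hmax' (k + 1 + 1) hj
    rw [h2, Pi.add_apply] at hB
    rw [h1, Pi.add_apply] at hA
    generalize u.getD (k + 1) 0 = a at *
    fin_cases a <;> simp at hhor hA hB

/-! ### Next and previous section column -/

/-- The least element of `S` above `c` (junk `c + 1` if there is none). [folklore] -/
def nextIn (S : Finset ℤ) (c : ℤ) : ℤ :=
  if h : (S.filter fun c' => c < c').Nonempty then (S.filter fun c' => c < c').min' h else c + 1

/-- `nextIn S c` is above `c`. [folklore] -/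
theorem lt_nextIn (S : Finset ℤ) (c : ℤ) : c < nextIn S c := by
  unfold nextIn
  split_ifs with h
  · have := Finset.min'_mem _ h
    rw [Finset.mem_filter] at this
    exact this.2
  · omega

/-- When `S` has an element above `c`, `nextIn S c` is the least such. [folklore] -/
theorem nextIn_spec {S : Finset ℤ} {c : ℤ} (h : ∃ c' ∈ S, c < c') :
    nextIn S c ∈ S ∧ ∀ c' ∈ S, c < c' → nextIn S c ≤ c' := by
  have hne : (S.filter fun c' => c < c').Nonempty := by
    obtain ⟨c', hc', hlt⟩ := h
    exact ⟨c', Finset.mem_filter.2 ⟨hc', hlt⟩⟩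
  unfold nextIn
  rw [dif_pos hne]
  refine ⟨(Finset.mem_filter.1 (Finset.min'_mem _ hne)).1, fun c' hc' hlt => ?_⟩
  exact Finset.min'_le _ _ (Finset.mem_filter.2 ⟨hc', hlt⟩)

/-- No element of `S` lies strictly between `c` and `nextIn S c`. [folklore] -/
theorem not_mem_of_lt_nextIn {S : Finset ℤ} {c g : ℤ} (h1 : c < g) (h2 : g < nextIn S c) :
    g ∉ S := by
  intro hg
  have := (nextIn_spec ⟨g, hg, h1⟩).2 g hg h1
  omega

/-- The largest element of `S` below `c` (junk `c - 1` if there is none). [folklore] -/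
def prevIn (S : Finset ℤ) (c : ℤ) : ℤ :=
  if h : (S.filter fun c' => c' < c).Nonempty then (S.filter fun c' => c' < c).max' h else c - 1

/-- `prevIn S c` is below `c`. [folklore] -/
theorem prevIn_lt (S : Finset ℤ) (c : ℤ) : prevIn S c < c := by
  unfold prevIn
  split_ifs with h
  · have := Finset.max'_mem _ h
    rw [Finset.mem_filter] at this
    exact this.2
  · omega

/-- When `S` has an element below `c`, `prevIn S c` is the largest such. [folklore] -/
theorem prevIn_spec {S : Finset ℤ} {c : ℤ} (h : ∃ c' ∈ S, c' < c) :
    prevIn S c ∈ S ∧ ∀ c' ∈ S, c' < c → c' ≤ prevIn S c := by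
  have hne : (S.filter fun c' => c' < c).Nonempty := by
    obtain ⟨c', hc', hlt⟩ := h
    exact ⟨c', Finset.mem_filter.2 ⟨hc', hlt⟩⟩
  unfold prevIn
  rw [dif_pos hne]
  refine ⟨(Finset.mem_filter.1 (Finset.max'_mem _ hne)).1, fun c' hc' hlt => ?_⟩
  exact Finset.le_max' _ _ (Finset.mem_filter.2 ⟨hc', hlt⟩)

/-- No element of `S` lies strictly between `prevIn S c` and `c`. [folklore] -/
theorem not_mem_of_prevIn_lt {S : Finset ℤ} {c g : ℤ} (h1 : prevIn S c < g) (h2 : g < c) :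
    g ∉ S := by
  intro hg
  have := (prevIn_spec ⟨g, hg, h2⟩).2 g hg h2
  omega

/-- For `c ∈ S`, the next element of `S` after `prevIn S c` is `c` itself. [folklore] -/
theorem nextIn_prevIn {S : Finset ℤ} {c : ℤ} (hc : c ∈ S) : nextIn S (prevIn S c) = c := by
  have hp := prevIn_lt S c
  obtain ⟨-, hmin⟩ := nextIn_spec ⟨c, hc, hp⟩
  have h1 := hmin c hc hp
  rcases h1.lt_or_eq with hlt | heq
  · exact absurd (nextIn_spec ⟨c, hc, hp⟩).1 (not_mem_of_prevIn_lt (lt_nextIn S _) hlt)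
  · exact heq

/-- The least element of `S` that is `≥ x` (junk `x` if there is none). [folklore] -/
def ceilIn (S : Finset ℤ) (x : ℤ) : ℤ :=
  if h : (S.filter fun c => x ≤ c).Nonempty then (S.filter fun c => x ≤ c).min' h else x

/-- When `S` has an element `≥ x`, `ceilIn S x` is the least such. [folklore] -/
theorem ceilIn_spec {S : Finset ℤ} {x : ℤ} (h : ∃ c ∈ S, x ≤ c) :
    ceilIn S x ∈ S ∧ x ≤ ceilIn S x ∧ ∀ g, x ≤ g → g < ceilIn S x → g ∉ S := by
  have hne : (S.filter fun c => x ≤ c).Nonempty := by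
    obtain ⟨c', hc', hle⟩ := h
    exact ⟨c', Finset.mem_filter.2 ⟨hc', hle⟩⟩
  unfold ceilIn
  rw [dif_pos hne]
  have hm := Finset.mem_filter.1 (Finset.min'_mem _ hne)
  refine ⟨hm.1, hm.2, fun g h1 h2 hg => ?_⟩
  have := Finset.min'_le _ g (Finset.mem_filter.2 ⟨hg, h1⟩)
  exact lt_irrefl _ (lt_of_lt_of_le h2 this)

/-! ### Runs of horizontal letters between section columns -/

/-- A run of equal letters inside a word, as a decomposition of a suffix. [folklore] -/
theorem drop_eq_replicate_append {α : Type*} (l : List α) (a d₀ : α) {i d : ℕ}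
    (hd : i + d ≤ l.length) (h : ∀ p < d, l.getD (i + p) d₀ = a) :
    l.drop i = List.replicate d a ++ l.drop (i + d) := by
  induction d generalizing i with
  | zero => simp
  | succ d ih =>
    have hi : i < l.length := by omega
    rw [List.drop_eq_getElem_cons hi, List.replicate_succ, List.cons_append]
    have h0 := h 0 (by omega)
    rw [add_zero, List.getD_eq_getElem _ _ hi] at h0
    rw [h0, ih (show i + 1 + d ≤ l.length by omega) fun p hp => ?_, show i + 1 + d = i + (d + 1)
      by ring]
    rw [show i + 1 + p = i + (p + 1) by ring]
    exact h (p + 1) (by omega)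

/-- **Run of `E`'s**: from a section column `x_i` an `E` continues eastwards up to the next
section column. [folklore] -/
theorem IsCanon.run_E (h : IsCanon u) {i : ℕ} (hi : i < u.length)
    (hE : u.getD i 0 = 0) {d : ℕ}
    (hd : (d : ℤ) = nextIn (secCols u) (vtx u i 0) - vtx u i 0) :
    i + d ≤ u.length ∧ (∀ p < d, u.getD (i + p) 0 = 0) ∧
      vtx u (i + d) 0 = nextIn (secCols u) (vtx u i 0) := by
  have hlt := lt_nextIn (secCols u) (vtx u i 0)
  have P : ∀ p < d, i + p < u.length ∧ u.getD (i + p) 0 = 0 ∧ vtx u (i + p) 0 = vtx u i 0 + p := by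
    intro p
    induction p with
    | zero => intro _; exact ⟨by simpa using hi, by simpa using hE, by simp⟩
    | succ p ih =>
      intro hp
      obtain ⟨h1, h2, h3⟩ := ih (by omega)
      have hx : vtx u (i + (p + 1)) 0 = vtx u i 0 + (p + 1 : ℕ) := by
        rw [← add_assoc, vtx_succ u h1, Pi.add_apply, ← List.getD_eq_getElem u 0 h1, h2, h3]
        simp only [stepVec_zero, Fin.isValue, Pi.single_eq_same, Nat.cast_add, Nat.cast_one]
        ring
      have hns : vtx u (i + (p + 1)) 0 ∉ secCols u :=
        not_mem_of_lt_nextIn (c := vtx u i 0) (by rw [hx]; push_cast; omega)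
          (by rw [hx]; push_cast; omega)
      have hle : i + (p + 1) ≤ u.length := by omega
      have hlt' : i + (p + 1) < u.length := by
        rcases hle.lt_or_eq with h' | h'
        · exact h'
        · exfalso
          rw [h', h.1.vtx_length_zero] at hns
          exact hns h.zero_mem_secCols
      refine ⟨hlt', ?_, hx⟩
      have := h.1.straight (j := i + p) (by simpa [add_assoc] using hlt') (by
        simpa [add_assoc] using hns)
      rw [← add_assoc, this.1, h2]
  rcases Nat.eq_zero_or_pos d with rfl | hdpos
  · simp at hd
    omega
  · obtain ⟨h1, h2, h3⟩ := P (d - 1) (by omega)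
    refine ⟨by omega, fun p hp => (P p hp).2.1, ?_⟩
    have := vtx_succ u h1
    rw [show i + (d - 1) + 1 = i + d by omega, ← List.getD_eq_getElem u 0 h1, h2] at this
    rw [this, Pi.add_apply, h3]
    simp only [stepVec_zero, Fin.isValue, Pi.single_eq_same]
    push_cast [Nat.cast_sub (show 1 ≤ d by omega)]
    omega

/-- **Run of `W`'s**: from a section column `x_i` a `W` continues westwards down to the previous
section column. [folklore] -/
theorem IsCanon.run_W (h : IsCanon u) {i : ℕ} (hi : i < u.length)
    (hW : u.getD i 0 = 1) {d : ℕ}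
    (hd : (d : ℤ) = vtx u i 0 - prevIn (secCols u) (vtx u i 0)) :
    i + d ≤ u.length ∧ (∀ p < d, u.getD (i + p) 0 = 1) ∧
      vtx u (i + d) 0 = prevIn (secCols u) (vtx u i 0) := by
  have hlt := prevIn_lt (secCols u) (vtx u i 0)
  have P : ∀ p < d, i + p < u.length ∧ u.getD (i + p) 0 = 1 ∧ vtx u (i + p) 0 = vtx u i 0 - p := by
    intro p
    induction p with
    | zero => intro _; exact ⟨by simpa using hi, by simpa using hW, by simp⟩
    | succ p ih =>
      intro hp
      obtain ⟨h1, h2, h3⟩ := ih (by omega)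
      have hx : vtx u (i + (p + 1)) 0 = vtx u i 0 - (p + 1 : ℕ) := by
        rw [← add_assoc, vtx_succ u h1, Pi.add_apply, ← List.getD_eq_getElem u 0 h1, h2, h3]
        simp only [stepVec_one, Fin.isValue, Pi.neg_apply, Pi.single_eq_same, Nat.cast_add,
          Nat.cast_one]
        ring
      have hns : vtx u (i + (p + 1)) 0 ∉ secCols u :=
        not_mem_of_prevIn_lt (c := vtx u i 0) (by rw [hx]; push_cast; omega)
          (by rw [hx]; push_cast; omega)
      have hle : i + (p + 1) ≤ u.length := by omega
      have hlt' : i + (p + 1) < u.length := by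
        rcases hle.lt_or_eq with h' | h'
        · exact h'
        · exfalso
          rw [h', h.1.vtx_length_zero] at hns
          exact hns h.zero_mem_secCols
      refine ⟨hlt', ?_, hx⟩
      have := h.1.straight (j := i + p) (by simpa [add_assoc] using hlt') (by
        simpa [add_assoc] using hns)
      rw [← add_assoc, this.1, h2]
  rcases Nat.eq_zero_or_pos d with rfl | hdpos
  · simp at hd
    omega
  · obtain ⟨h1, h2, h3⟩ := P (d - 1) (by omega)
    refine ⟨by omega, fun p hp => (P p hp).2.1, ?_⟩
    have := vtx_succ u h1
    rw [show i + (d - 1) + 1 = i + d by omega, ← List.getD_eq_getElem u 0 h1, h2] at this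
    rw [this, Pi.add_apply, h3]
    simp only [stepVec_one, Fin.isValue, Pi.neg_apply, Pi.single_eq_same]
    push_cast [Nat.cast_sub (show 1 ≤ d by omega)]
    omega

/-! ### The collapsing width function `theta` and `restretch (theta u) 0 u = u` -/

/-- The width function that collapses every run of non-section columns: the gap starting at a
section column `c` gets width (distance to the next section column), every other gap width `0`.
[folklore] -/
def theta (u : List (Fin 4)) (g : ℤ) : ℕ :=
  if g ∈ secCols u then (nextIn (secCols u) g - g).toNat else 0

/-- `theta` at a section column. [folklore] -/
theorem theta_of_mem {g : ℤ} (hg : g ∈ secCols u) :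
    (theta u g : ℤ) = nextIn (secCols u) g - g := by
  rw [theta, if_pos hg, Int.toNat_of_nonneg]
  have := lt_nextIn (secCols u) g
  omega

/-- `theta` off the section columns. [folklore] -/
theorem theta_of_not_mem {g : ℤ} (hg : g ∉ secCols u) : theta u g = 0 := by
  rw [theta, if_neg hg]

/-- **Collapsing runs changes nothing**: `restretch (theta u) 0 u = u` for a canonical word —
each maximal horizontal run between consecutive section columns `c < c'` is reproduced by the
single width `theta u c = c' - c`. [folklore] -/
theorem IsCanon.restretch_theta (h : IsCanon u) : restretch (theta u) 0 u = u := by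
  suffices key : ∀ n i, u.length - i = n → i ≤ u.length → vtx u i 0 ∈ secCols u →
      restretch (theta u) (vtx u i 0) (u.drop i) = u.drop i by
    simpa using key u.length 0 (by simp) (Nat.zero_le _) (by simpa using h.zero_mem_secCols)
  intro n
  induction n using Nat.strong_induction_on with
  | _ n ih =>
    intro i hn hi hS
    rcases hi.lt_or_eq with hlt | rfl
    swap
    · simp
    have hdrop : u.drop i = u[i] :: u.drop (i + 1) := List.drop_eq_getElem_cons hlt
    have hgetD : u.getD i 0 = u[i] := List.getD_eq_getElem u 0 hlt
    by_cases hv : 2 ≤ (u[i]).val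
    · -- vertical letter: copied, same column
      have hx : vtx u (i + 1) 0 = vtx u i 0 := by
        rw [vtx_succ u hlt, Pi.add_apply, stepVec_apply_zero_eq_zero hv, add_zero]
      rw [hdrop, restretch_cons, stepVec_apply_zero_eq_zero hv, add_zero]
      have hm : mult (theta u) (vtx u i 0) u[i] = 1 := by
        rw [mult, if_neg (by omega)]
      rw [hm, List.replicate_one, List.singleton_append, ← hx,
        ih (u.length - (i + 1)) (by omega) (i + 1) rfl hlt (hx ▸ hS)]
    · have hhor : (u[i]).val < 2 := not_le.1 hv
      have h01 : u[i] = 0 ∨ u[i] = 1 := by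
        revert hhor; generalize u[i] = a; intro hhor; fin_cases a <;> simp at hhor ⊢
      rcases h01 with hE | hW
      · -- run of E's up to the next section column
        obtain ⟨b, hb, hbmax⟩ := h.exists_secCol_ge
        have hnext : ∃ c' ∈ secCols u, vtx u i 0 < c' := by
          refine ⟨b, hb, ?_⟩
          have := hbmax (i + 1) hlt
          rw [vtx_succ u hlt, hE, Pi.add_apply] at this
          simpa using this
        set c' := nextIn (secCols u) (vtx u i 0) with hc'
        have hltc : vtx u i 0 < c' := lt_nextIn _ _
        obtain ⟨d, hd⟩ : ∃ d : ℕ, (d : ℤ) = c' - vtx u i 0 := ⟨(c' - vtx u i 0).toNat, by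
          rw [Int.toNat_of_nonneg (by omega)]⟩
        have hdpos : 0 < d := by
          have : (0 : ℤ) < d := by omega
          exact_mod_cast this
        obtain ⟨hid, hrun, hxend⟩ := h.run_E hlt (hgetD.trans hE) hd
        have hsplit := drop_eq_replicate_append u (0 : Fin 4) 0 hid hrun
        rw [hsplit, restretch_append, restretch_replicate_E, List.length_replicate,
          vtx_replicate _ _ le_rfl, Pi.smul_apply]
        have hsum : ∑ j ∈ Finset.range d, theta u (vtx u i 0 + j) = d := by
          rw [Finset.sum_eq_single_of_mem 0 (by simp; omega)]
          · have := theta_of_mem hS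
            simp only [Nat.cast_zero, add_zero]
            omega
          · intro j hj hj0
            rw [Finset.mem_range] at hj
            exact theta_of_not_mem (not_mem_of_lt_nextIn (c := vtx u i 0) (by omega)
              (by rw [← hc']; omega))
        rw [hsum]
        congr 1
        have hx : vtx u i 0 + d • stepVec (0 : Fin 4) 0 = vtx u (i + d) 0 := by
          rw [hxend]
          simp only [stepVec_zero, Fin.isValue, Pi.single_eq_same, mul_one, nsmul_eq_mul]
          omega
        rw [hx]
        exact ih (u.length - (i + d)) (by omega) (i + d) rfl hid
          (hxend ▸ (nextIn_spec hnext).1)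
      · -- run of W's down to the previous section column
        obtain ⟨a, ha, hamin⟩ := h.exists_secCol_le
        have hprev : ∃ c' ∈ secCols u, c' < vtx u i 0 := by
          refine ⟨a, ha, ?_⟩
          have := hamin (i + 1) hlt
          rw [vtx_succ u hlt, hW, Pi.add_apply] at this
          simp only [stepVec_one, Fin.isValue, Pi.neg_apply, Pi.single_eq_same] at this
          omega
        set c' := prevIn (secCols u) (vtx u i 0) with hc'
        have hltc : c' < vtx u i 0 := prevIn_lt _ _
        obtain ⟨d, hd⟩ : ∃ d : ℕ, (d : ℤ) = vtx u i 0 - c' := ⟨(vtx u i 0 - c').toNat, by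
          rw [Int.toNat_of_nonneg (by omega)]⟩
        have hdpos : 0 < d := by
          have : (0 : ℤ) < d := by omega
          exact_mod_cast this
        obtain ⟨hid, hrun, hxend⟩ := h.run_W hlt (hgetD.trans hW) hd
        have hsplit := drop_eq_replicate_append u (1 : Fin 4) 0 hid hrun
        rw [hsplit, restretch_append, restretch_replicate_W, List.length_replicate,
          vtx_replicate _ _ le_rfl, Pi.smul_apply]
        have hcnext : nextIn (secCols u) c' = vtx u i 0 := by
          rw [hc']
          exact nextIn_prevIn hS
        have hsum : ∑ j ∈ Finset.range d, theta u (vtx u i 0 - 1 - j) = d := by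
          rw [Finset.sum_eq_single_of_mem (d - 1) (by simp; omega)]
          · have hg : vtx u i 0 - 1 - ((d - 1 : ℕ) : ℤ) = c' := by
              push_cast [Nat.cast_sub (show 1 ≤ d by omega)]
              omega
            rw [hg]
            have := theta_of_mem (prevIn_spec hprev).1
            rw [← hc', hcnext] at this
            omega
          · intro j hj hj0
            rw [Finset.mem_range] at hj
            exact theta_of_not_mem (not_mem_of_prevIn_lt (c := vtx u i 0) (by rw [← hc']; omega)
              (by omega))
        rw [hsum]
        congr 1
        have hx : vtx u i 0 + d • stepVec (1 : Fin 4) 0 = vtx u (i + d) 0 := by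
          rw [hxend]
          simp only [stepVec_one, Fin.isValue, Pi.neg_apply, Pi.single_eq_same, mul_neg, mul_one,
            nsmul_eq_mul]
          omega
        rw [hx]
        exact ih (u.length - (i + d)) (by omega) (i + d) rfl hid
          (hxend ▸ (prevIn_spec hprev).1)

/-! ### Contraction and re-inflation -/

/-- The indicator of the section columns: widths that keep a horizontal bond iff its gap starts
at a section column. [folklore] -/
def chi (u : List (Fin 4)) (g : ℤ) : ℕ := if g ∈ secCols u then 1 else 0

/-- **The contracted word**: delete every horizontal bond whose gap does not start at a section
column (all duplicate columns deleted at once). [cite: Rechnitzer2006Haruspicy2, §2.1, Definition 3] -/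
def contract (u : List (Fin 4)) : List (Fin 4) := restretch (chi u) 0 u

/-- `Φ_χ` separates the section columns (it counts them). [folklore] -/
theorem Phi_chi_lt_of_mem {c c' : ℤ} (hc : c ∈ secCols u) (hlt : c < c') :
    Phi (chi u) c < Phi (chi u) c' := by
  have h1 := Phi_sub_Phi (chi u) hlt.le
  have h2 : (chi u c : ℤ) ≤ ∑ g ∈ Finset.Ico c c', (chi u g : ℤ) :=
    Finset.single_le_sum (f := fun g => (chi u g : ℤ)) (fun _ _ => by positivity)
      (Finset.mem_Ico.2 ⟨le_rfl, hlt⟩)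
  have h3 : chi u c = 1 := by rw [chi, if_pos hc]
  rw [h3] at h2
  push_cast at h2
  omega

/-- `Φ_χ` is injective on the section columns. [folklore] -/
theorem Phi_chi_injOn : Set.InjOn (Phi (chi u)) (secCols u : Set ℤ) := by
  intro c hc c' hc' h
  rcases lt_trichotomy c c' with hlt | rfl | hgt
  · exact absurd h (Phi_chi_lt_of_mem hc hlt).ne
  · rfl
  · exact absurd h.symm (Phi_chi_lt_of_mem hc' hgt).ne

/-- **The re-inflating widths** of `u`, as a function of the gaps of `contract u`: the gap of the
contracted word starting at the image `Φ_χ(c)` of a section column `c` gets width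
`theta u c` (and width `1` elsewhere, so that all widths are positive). [folklore] -/
def tauOf (u : List (Fin 4)) (g : ℤ) : ℕ :=
  if h : ((secCols u).filter fun c => Phi (chi u) c = g).Nonempty then
    theta u (((secCols u).filter fun c => Phi (chi u) c = g).min' h)
  else 1

/-- `tauOf` at the image of a section column. [folklore] -/
theorem tauOf_Phi_chi {c : ℤ} (hc : c ∈ secCols u) : tauOf u (Phi (chi u) c) = theta u c := by
  have hne : ((secCols u).filter fun c' => Phi (chi u) c' = Phi (chi u) c).Nonempty :=
    ⟨c, Finset.mem_filter.2 ⟨hc, rfl⟩⟩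
  rw [tauOf, dif_pos hne]
  congr 1
  have hm := Finset.mem_filter.1 (Finset.min'_mem _ hne)
  exact Phi_chi_injOn hm.1 hc hm.2

/-- All re-inflating widths are positive. [folklore] -/
theorem one_le_tauOf (u : List (Fin 4)) (g : ℤ) : 1 ≤ tauOf u g := by
  unfold tauOf
  split_ifs with h
  · have hm := (Finset.mem_filter.1 (Finset.min'_mem _ h)).1
    have := theta_of_mem hm
    have hlt := lt_nextIn (secCols u) (((secCols u).filter fun c => Phi (chi u) c = g).min' h)
    have : (1 : ℤ) ≤ theta u (((secCols u).filter fun c => Phi (chi u) c = g).min' h) := by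
      omega
    exact_mod_cast this
  · exact le_rfl

/-- Contracting and then re-inflating composes to the collapsing widths `theta`. [folklore] -/
theorem comp_chi_tauOf (u : List (Fin 4)) : comp (chi u) (tauOf u) = theta u := by
  funext g
  unfold comp
  by_cases hg : g ∈ secCols u
  · rw [show chi u g = 1 by rw [chi, if_pos hg], Finset.sum_range_one, Nat.cast_zero, add_zero,
      tauOf_Phi_chi hg]
  · rw [show chi u g = 0 by rw [chi, if_neg hg], Finset.sum_range_zero, theta_of_not_mem hg]

/-- **Re-inflating the contraction gives back the word**. [folklore] -/
theorem IsCanon.restretch_tauOf_contract (h : IsCanon u) :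
    restretch (tauOf u) 0 (contract u) = u := by
  have := restretch_restretch (chi u) (tauOf u) 0 u
  rw [Phi_zero, comp_chi_tauOf, h.restretch_theta] at this
  exact this

/-! ### Block starts of a re-stretching read from column `0` -/

/-- The start of block `K`: the index in `restretch τ 0 w` of the image of the `K`-th vertex.
[folklore] -/
def bs (τ : ℤ → ℕ) (w : List (Fin 4)) (K : ℕ) : ℕ := (restretch τ 0 (w.take K)).length

/-- Block `0` starts at `0`. [folklore] -/
@[simp] theorem bs_zero (τ : ℤ → ℕ) (w : List (Fin 4)) : bs τ w 0 = 0 := by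
  simp [bs]

/-- Consecutive block starts differ by the multiplicity. [folklore] -/
theorem bs_succ (τ : ℤ → ℕ) (w : List (Fin 4)) {K : ℕ} (hK : K < w.length) :
    bs τ w (K + 1) = bs τ w K + mult τ (vtx w K 0) w[K] := by
  rw [bs, bs, length_restretch_take_succ τ 0 w hK, zero_add]

/-- The last block ends at the end of the re-stretched word. [folklore] -/
theorem bs_length (τ : ℤ → ℕ) (w : List (Fin 4)) : bs τ w w.length = (restretch τ 0 w).length := by
  rw [bs, List.take_length]

/-- Block starts are monotone. [folklore] -/
theorem bs_mono (τ : ℤ → ℕ) (w : List (Fin 4)) {K K' : ℕ} (h : K ≤ K') : bs τ w K ≤ bs τ w K' :=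
  length_restretch_take_mono τ 0 w h

/-- With positive widths block starts are strictly monotone. [folklore] -/
theorem bs_lt_bs {τ : ℤ → ℕ} (h1 : ∀ g, 1 ≤ τ g) (w : List (Fin 4)) {K K' : ℕ} (h : K < K')
    (hK' : K' ≤ w.length) : bs τ w K < bs τ w K' := by
  have := bs_succ τ w (show K < w.length by omega)
  have hm := one_le_mult h1 (vtx w K 0) w[K]
  have := bs_mono τ w (show K + 1 ≤ K' by omega)
  omega

/-- The re-stretched word splits at a block start. [folklore] -/
theorem restretch_eq_append_bs (τ : ℤ → ℕ) (w : List (Fin 4)) {K : ℕ} (hK : K ≤ w.length) :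
    restretch τ 0 w = restretch τ 0 (w.take K) ++ restretch τ (vtx w K 0) (w.drop K) := by
  conv_lhs => rw [← List.take_append_drop K w]
  rw [restretch_append, List.length_take, min_eq_left hK, vtx_take _ le_rfl, zero_add]

/-- **Image of a vertex, column**: the block start `K` sits in column `Φ_τ(x_K)`. [folklore] -/
theorem vtx_bs_zero (τ : ℤ → ℕ) (w : List (Fin 4)) {K : ℕ} (hK : K ≤ w.length) :
    vtx (restretch τ 0 w) (bs τ w K) 0 = Phi τ (vtx w K 0) := by
  rw [restretch_eq_append_bs τ w hK, bs, vtx_append_left _ _ le_rfl, vtx_restretch_take_zero τ 0 w hK,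
    zero_add, Phi_zero, sub_zero]

/-- **Image of a vertex, height**: unchanged. [folklore] -/
theorem vtx_bs_one (τ : ℤ → ℕ) (w : List (Fin 4)) {K : ℕ} (hK : K ≤ w.length) :
    vtx (restretch τ 0 w) (bs τ w K) 1 = vtx w K 1 := by
  rw [restretch_eq_append_bs τ w hK, bs, vtx_append_left _ _ le_rfl, vtx_restretch_take_one τ 0 w hK]

/-- Vertices inside block `K`. [folklore] -/
theorem vtx_bs_add (τ : ℤ → ℕ) (w : List (Fin 4)) {K s : ℕ} (hK : K < w.length)
    (hs : s ≤ mult τ (vtx w K 0) w[K]) :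
    vtx (restretch τ 0 w) (bs τ w K + s) = vtx (restretch τ 0 w) (bs τ w K) + s • stepVec w[K] := by
  have h := vtx_restretch τ 0 w (s := s) hK (by rwa [zero_add])
  rw [bs, h, restretch_eq_append_bs τ w hK.le, vtx_append_left _ _ le_rfl]

/-- Letters inside block `K` are copies of `w_K`. [folklore] -/
theorem getD_bs_add (τ : ℤ → ℕ) (w : List (Fin 4)) {K s : ℕ} (hK : K < w.length)
    (hs : s < mult τ (vtx w K 0) w[K]) : (restretch τ 0 w).getD (bs τ w K + s) 0 = w[K] := by
  rw [restretch_eq_append_bs τ w hK.le, bs, List.getD_append_right _ _ _ _ (Nat.le_add_right _ _),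
    Nat.add_sub_cancel_left, List.drop_eq_getElem_cons hK, restretch_cons,
    List.getD_append _ _ _ _ (by simpa using hs), List.getD_replicate _ hs]

/-- Every index of the re-stretched word is `bs K + s` with `s` below the multiplicity.
[folklore] -/
theorem exists_bs (τ : ℤ → ℕ) (w : List (Fin 4)) {J : ℕ} (hJ : J < (restretch τ 0 w).length) :
    ∃ K s, ∃ hK : K < w.length, s < mult τ (vtx w K 0) w[K] ∧ J = bs τ w K + s := by
  obtain ⟨K, s, hK, hs, hJ⟩ := exists_block τ 0 w hJ
  refine ⟨K, s, hK, ?_, hJ⟩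
  rwa [zero_add, List.getD_eq_getElem w 0 hK] at hs

/-! ### The contraction of a canonical word -/

/-- Contraction keeps the vertical bonds. [folklore] -/
theorem vcount_contract (u : List (Fin 4)) : vcount (contract u) = vcount u :=
  vcount_restretch _ _ _

/-- The images in `u` of the vertices of `contract u`: the block starts of the re-inflation are
pairwise distinct vertices of `u`. [folklore] -/
theorem IsCanon.vtx_bs_contract (h : IsCanon u) {K : ℕ} (hK : K ≤ (contract u).length) :
    vtx u (bs (tauOf u) (contract u) K) 0 = Phi (tauOf u) (vtx (contract u) K 0) ∧
      vtx u (bs (tauOf u) (contract u) K) 1 = vtx (contract u) K 1 := by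
  have e := h.restretch_tauOf_contract
  have h0 := vtx_bs_zero (tauOf u) (contract u) hK
  have h1 := vtx_bs_one (tauOf u) (contract u) hK
  rw [e] at h0 h1
  exact ⟨h0, h1⟩

/-- The re-inflation of the contraction has `|u|` letters. [folklore] -/
theorem IsCanon.bs_contract_length (h : IsCanon u) :
    bs (tauOf u) (contract u) (contract u).length = u.length := by
  rw [bs_length, h.restretch_tauOf_contract]

/-- `Φ_τ` for positive widths is non-negative exactly on non-negative columns. [folklore] -/
theorem Phi_nonneg_iff {τ : ℤ → ℕ} (h1 : ∀ g, 1 ≤ τ g) {x : ℤ} : 0 ≤ Phi τ x ↔ 0 ≤ x := by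
  constructor
  · intro h
    by_contra hx
    have := Phi_strictMono τ h1 (show x < 0 by omega)
    rw [Phi_zero] at this
    omega
  · intro h
    have := Phi_mono τ h
    rwa [Phi_zero] at this

/-- **The contraction of a canonical word is canonical.** [folklore] -/
theorem IsCanon.isCanon_contract (h : IsCanon u) : IsCanon (contract u) := by
  have h1 := one_le_tauOf u
  have hlenu := h.bs_contract_length
  -- closedness
  have hclosed : ((contract u).map stepVec).sum = 0 := by
    rw [← vtx_length, site_eq_iff, contract, vtx_restretch_length_zero,
      vtx_restretch_length_one, zero_add, Phi_zero, sub_zero, h.1.vtx_length_zero, Phi_zero,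
      vtx_length, h.1.2.1]
    exact ⟨rfl, rfl⟩
  -- self-avoidance through the images in `u`
  have aux : ∀ K K', K' < (contract u).length → vtx (contract u) K = vtx (contract u) K' →
      K < K' → False := by
    intro K K' hK' hKK' hlt
    have hb := bs_lt_bs h1 (contract u) hlt hK'.le
    have hb' := bs_lt_bs h1 (contract u) hK' le_rfl
    rw [hlenu] at hb'
    have hv : vtx u (bs (tauOf u) (contract u) K) = vtx u (bs (tauOf u) (contract u) K') := by
      rw [site_eq_iff, (h.vtx_bs_contract (hlt.le.trans hK'.le)).1,
        (h.vtx_bs_contract (hlt.le.trans hK'.le)).2, (h.vtx_bs_contract hK'.le).1,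
        (h.vtx_bs_contract hK'.le).2, hKK']
      exact ⟨rfl, rfl⟩
    have := h.1.2.2 (show bs (tauOf u) (contract u) K ∈ Set.Iio u.length by simp; omega)
      (show bs (tauOf u) (contract u) K' ∈ Set.Iio u.length by simpa using hb') hv
    omega
  have hinj : Set.InjOn (vtx (contract u)) (Set.Iio (contract u).length) := by
    intro K hK K' hK' hKK'
    simp only [Set.mem_Iio] at hK hK'
    by_contra hne
    rcases lt_or_gt_of_ne hne with hlt | hlt
    · exact aux K K' hK' hKK' hlt
    · exact aux K' K hK hKK'.symm hlt
  -- the first letter E is kept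
  have hhead : (contract u).head? = some 0 := by
    have hu : u = 0 :: u.tail := by
      have := h.2.2
      cases u with
      | nil => simp at this
      | cons a u' =>
        simp only [List.head?_cons, Option.some.injEq] at this
        simp [this]
    have hchi : chi u 0 = 1 := by rw [chi, if_pos h.zero_mem_secCols]
    rw [contract]
    conv_lhs => arg 1; arg 3; rw [hu]
    rw [restretch_cons, mult_E, hchi]
    rfl
  -- length ≥ 4 from the letter counts
  have hlen : 4 ≤ (contract u).length := by
    have hE : 1 ≤ (contract u).count 0 := by
      cases hw' : contract u with
      | nil => rw [hw'] at hhead; simp at hhead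
      | cons a w' =>
        rw [hw'] at hhead
        simp only [List.head?_cons, Option.some.injEq] at hhead
        subst hhead
        simp
    have hS : 1 ≤ (contract u).count 3 := by
      have hv : 1 ≤ vcount u := by
        obtain ⟨h3, -⟩ := h.getD_length_sub_one
        have hN : u.length - 1 < u.length := by have := h.1.1; omega
        rw [List.getD_eq_getElem _ _ hN] at h3
        have hmem : u[u.length - 1] ∈ u := List.getElem_mem hN
        rw [h3] at hmem
        have := List.count_pos_iff.2 hmem
        rw [vcount_eq_count]
        omega
      rw [← vcount_contract, vcount_eq_count] at hv
      have h0 := congrFun hclosed 1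
      rw [sum_map_stepVec_apply_one] at h0
      simp only [Pi.zero_apply] at h0
      omega
    have h0 := congrFun hclosed 0
    rw [sum_map_stepVec_apply_zero] at h0
    have h0' := congrFun hclosed 1
    rw [sum_map_stepVec_apply_one] at h0'
    simp only [Pi.zero_apply] at h0 h0'
    have := hcount_add_vcount (contract u)
    rw [hcount_eq_count, vcount_eq_count] at this
    omega
  refine ⟨⟨hlen, hclosed, hinj⟩, ?_, hhead⟩
  -- rooted: keys are compared through the images in `u`
  intro K hK
  have hb : bs (tauOf u) (contract u) K < u.length := by
    have := bs_lt_bs h1 (contract u) hK le_rfl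
    rwa [hlenu] at this
  have hr := h.2.1 _ hb
  rw [key_le_key, (h.vtx_bs_contract hK.le).1, (h.vtx_bs_contract hK.le).2] at hr
  rw [key_le_key]
  simp only [Pi.zero_apply] at hr ⊢
  rcases hr with hr | ⟨hr1, hr2⟩
  · exact Or.inl hr
  · exact Or.inr ⟨hr1, (Phi_nonneg_iff h1).1 hr2⟩

/-- `Φ_χ` is constant from a column up to the next section column at or above it. [folklore] -/
theorem Phi_chi_ceilIn {x : ℤ} (hx : ∃ c ∈ secCols u, x ≤ c) :
    Phi (chi u) (ceilIn (secCols u) x) = Phi (chi u) x := by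
  obtain ⟨-, hle, hnot⟩ := ceilIn_spec hx
  have h1 := Phi_sub_Phi (chi u) hle
  rw [Finset.sum_eq_zero] at h1
  · omega
  · intro g hg
    rw [Finset.mem_Ico] at hg
    rw [chi, if_neg (hnot g hg.1 hg.2), Nat.cast_zero]

/-- **The contraction of a canonical word is column-minimal.** [folklore] -/
theorem IsCanon.isColMin_contract (h : IsCanon u) : IsColMin (contract u) := by
  intro K hK
  -- `K` is a block start of the contraction `restretch (chi u) 0 u`
  obtain ⟨i, s, hi, hs, hK'⟩ := exists_bs (chi u) u (by simpa [contract] using hK)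
  have hm1 : mult (chi u) (vtx u i 0) u[i] ≤ 1 := by
    unfold mult chi
    split_ifs <;> omega
  have hs0 : s = 0 := by omega
  subst hs0
  rw [add_zero] at hK'
  have hx : vtx (contract u) K 0 = Phi (chi u) (vtx u i 0) := by
    rw [hK', contract, vtx_bs_zero _ _ hi.le]
  -- the section column at or above `x_i`
  obtain ⟨b, hb, hbmax⟩ := h.exists_secCol_ge
  have hex : ∃ c ∈ secCols u, vtx u i 0 ≤ c := ⟨b, hb, hbmax i hi.le⟩
  obtain ⟨hcmem, -, -⟩ := ceilIn_spec hex
  obtain ⟨j, hj, hjv, hjx⟩ := mem_secCols.1 hcmem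
  -- its vertical letter survives in the contraction, at block start `bs j`
  have hmj : mult (chi u) (vtx u j 0) u[j] = 1 := by
    rw [mult, if_neg]
    rw [← List.getD_eq_getElem u 0 hj]
    omega
  have hbj : bs (chi u) u j < (contract u).length := by
    have := bs_succ (chi u) u hj
    have h2 := bs_mono (chi u) u (show j + 1 ≤ u.length by omega)
    rw [bs_length] at h2
    rw [contract]
    omega
  rw [mem_secCols]
  refine ⟨bs (chi u) u j, hbj, ?_, ?_⟩
  · have := getD_bs_add (chi u) u hj (s := 0) (by omega)
    rw [add_zero] at this
    rw [contract, this, ← List.getD_eq_getElem u 0 hj]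
    exact hjv
  · rw [contract, vtx_bs_zero _ _ hj.le, hjx, Phi_chi_ceilIn hex, ← hx, contract]

end Haruspicy

end Literature.Barriers.CriticalPhenomena
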